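import Summits.BirchSwinnertonDyer.BirchSwinnertonDyer.Theorems.TeichmullerTwistDescentKOfRationalPrincipalSeries
import Summits.BirchSwinnertonDyer.BirchSwinnertonDyer.Theorems.TeichmullerTwistDescentTameExponent
import Literature.NumberTheory.EllipticCurves.FullLevelHomologyTamePrincipalSeriesType
import Literature.NumberTheory.EllipticCurves.KellerYin2024.PotentiallyGoodOrdinaryPConverse
import Literature.NumberTheory.EllipticCurves.ModularSymbolsEichlerShimuraHoldsProofs
import Literature.NumberTheory.EllipticCurves.PAdicLFunctionProofs
import Mathlib.RepresentationTheory.Maschke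
import Mathlib.RingTheory.SimpleModule.Isotypic
import Mathlib.RingTheory.Flat.TorsionFree
import HarnessLib

/-!
# Route `TeichmullerTwistDescent`, crux K `TwistedPeriodLatticeSaturation` (stmt-BirchSwinnertonDyer-25368):
# the automorphic input (I1ᴷ) DISCHARGED from the published tame-type fact — K from modularity, the TYPE of the
# full-level homology (Eichler–Shimura + Carayol + Serre–Tate + Casselman, cite-only) and the weight exclusion (W‴)

Cell `pub/bsd-wall` (D-0145 line route-BirchSwinnertonDyer-TeichmullerTwistDescent, OPEN rev 7), seat `bsd-line-ttd-p1`
(prover 1/2, g27).  THEOREMS ONLY (no definition, no named fact, no `sorry`, no instance, no notation);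
`--supports stmt-BirchSwinnertonDyer-25368`.  BSD is not proved by this file; K is NOT proved by this file (it stays
CONDITIONAL); nothing here closes an item.

WHAT.  After g26 the K-line read **K ⟸ `exists_isNewformOf` ∧ (I1ᴷ) ∧ (W‴)** with (I1ᴷ)
`TamePrincipalSeriesFunctionalOverField` a ROUTE-POSITED hypothesis: «for some field `K ⊇ ℚ_p` there is a nonzero
`GL₂(𝔽_p)`-equivariant `ℤ_p`-linear map `Λ_Q(f_D) → Ind(ω̃^{p−1−b} ⊗ ω̃ᵇ)_K`».  This file DERIVES (I1ᴷ) from the published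
fact `Literature.NumberTheory.EllipticCurves.fullLevelHomology_isIsotypic_tamePrincipalSeries` (the `f_W`-part of the
full-level homology `H₁(Y(K(p)K₀(M)), K)` of a potentially good ordinary additive `p`, `e ∈ {3,4,6}`, is isotypic of type the
tame principal series `Ind(ω̃^{−b} ⊗ ω̃ᵇ)`, `e·b = p − 1`: Conrad–Diamond–Taylor 1999 Lemma 4.2.4 (2), §5.3, Lemma 7.1.3 (2);
Carayol 1986; Serre 1972 §5.6), so that the K-line's automorphic input is no longer route-posited:

  **K ⟸ `exists_isNewformOf` ∧ `fullLevelHomology_isIsotypic_tamePrincipalSeries` ∧ (W‴) `NoEtaleWeightEigenQuotient`.**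

HOW (`tamePrincipalSeriesFunctionalOverField_of_tameType`).  For `W, p, M, D` in the prefix of (I1ᴷ):
* the prefix gives the fact's hypotheses: `5 ≤ p`; (G)-ordinary ⟹ `W.HasPotentiallyGoodOrdinaryReductionAtPrime p`
  (`hasPotentiallyGoodOrdinaryReductionAtPrime_of_forall_intermediateField`); `ord_pΔ_min ∈ {2,3,4}` so `≠ 6`
  (`TameExponent.padicValInt_mem`); `e · tameExponent p W = p − 1` (`TameExponent.semistabilityIndex_mul_tameExponent`);
* the lattice `Λ := Λ_Q(f_D) = spreadLattice ℤ_p p M hpM D.f` carries the translation representation `ρ`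
  (`exists_translationRep`, from `spreadLattice_translate_mem`) and `V := ℚ_p ⊗_{ℤ_p} Λ` its base change `σ`
  (`exists_baseChangeRep`); `Φ := (1 ⊗ ·) ∘ spreadElt : H₁(Γ₀(M), ℤ_p[GL₂(𝔽_p)]) → V` is equivariant
  (`spreadElt_H1carrierRep`), Hecke-trivialised at `W` (`spreadPeriod_heckeT`, `T_q f_D = a_q(W) f_D` from `D.isNewformOf`)
  and its image spans `V` (`span_tmul_eq_top`); `V` is finite over `ℚ_p` (`moduleFinite_spreadLattice`);
* the fact makes `V` isotypic of type `coordRep(ω̃^{p−1−b}, ω̃ᵇ)_{ℚ_p}`; `V ≠ 0` (`Λ_f` is a lattice by the tree theorem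
  `isZLattice_periodLattice_holds`, `Λ ↠ ℤ_p ⊗ Λ_f` at `g = 1`, and `x ↦ 1 ⊗ x` is injective on the flat modules `Λ_f / ℤ`,
  `Λ / ℤ_p`: `one_tmul_ne_zero`); Maschke (`IsSemisimpleModule ℚ_p[GL₂(𝔽_p)] V`) and
  `exists_linearMap_apply_ne_zero_of_isIsotypicOfType` give a `ℚ_p[GL₂(𝔽_p)]`-linear `θ : V → coordRep_{ℚ_p}` with
  `θ (Φ z₀) ≠ 0`; `Ψ := θ ∘ (1 ⊗ ·)` is the required nonzero equivariant `ℤ_p`-linear map, with `K = ℚ_p`.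
Then `twistedPeriodLatticeSaturation_of_tameType_of_noEtaleWeightEigenQuotient (hnf) (hT) (hW) : K` (route decl
verbatim, via g26's `twistedPeriodLatticeSaturation_of_field_of_noEtaleWeightEigenQuotient`) and the GE11 certificate.

[cite: ConradDiamondTaylor1999, Lemma 4.2.4 (2), §5.3, Lemma 7.1.3 (2)] [cite: AshStevens1986, §1 (1.2)–(1.4)]
[cite: SerreLinearRepresentations1977, §2.6 Thm. 8 and §15.2] [cite: EdixhovenManin1991, §4]
-/

set_option autoImplicit false
-- single-conjunct summit: `Summit.BirchSwinnertonDyer.BirchSwinnertonDyer.…` repeats the name by design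
set_option linter.dupNamespace false

noncomputable section

open scoped Pointwise MatrixGroups TensorProduct

open Function CongruenceSubgroup
open Literature.RepresentationTheory.FiniteGroups Literature.RepresentationTheory.FiniteGroups.GL2
  Literature.NumberTheory.EllipticCurves.ModularForms
open Literature.NumberTheory.EllipticCurves (Kato2004.teichmullerChar)
open Literature.NumberTheory.ModularSymbols Literature.NumberTheory.ModularSymbols.FullLevel
open Literature.Algebra.Homology
open Literature.NumberTheory.Automorphic (TwistedQuotient.resScalars TwistedQuotient.resScalars_apply)

namespace Summit.BirchSwinnertonDyer.BirchSwinnertonDyer.Theorems.TeichmullerTwistDescent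

open WeierstrassCurve Literature.NumberTheory.EllipticCurves
open Summit.BirchSwinnertonDyer.BirchSwinnertonDyer.Theses.TeichmullerTwistDescent

namespace KOfTameType

/-! ### Generic algebra: isotypic modules, base change, flatness -/

/-- In a semisimple module which is isotypic of type `S`, every nonzero vector is seen by some linear map to `S`
(`M ≅ ⊕_ι S`, take a coordinate projection). [cite: SerreLinearRepresentations1977, §2.6 Thm. 8] -/
theorem exists_linearMap_apply_ne_zero_of_isIsotypicOfType {R M S : Type*} [Ring R] [AddCommGroup M] [Module R M]
    [AddCommGroup S] [Module R S] [IsSemisimpleModule R M] (h : IsIsotypicOfType R M S) {v : M} (hv : v ≠ 0) :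
    ∃ θ : M →ₗ[R] S, θ v ≠ 0 := by
  obtain ⟨ι, ⟨e⟩⟩ := h.linearEquiv_finsupp
  have hev : e v ≠ 0 := fun h0 => hv (e.map_eq_zero_iff.mp h0)
  obtain ⟨i, hi⟩ : ∃ i, e v i ≠ 0 := by
    by_contra hall
    push Not at hall
    exact hev (Finsupp.ext hall)
  exact ⟨(Finsupp.lapply i).comp e.toLinearMap, hi⟩

/-- **Base change of a representation**: a representation `ρ` of `G` on an `R`-module `Λ` extends to `A ⊗_R Λ` by
`g ↦ (ρ g) ⊗ 1`, acting by `a ⊗ x ↦ a ⊗ ρ g x`. [cite: SerreLinearRepresentations1977, §15.2] -/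
theorem exists_baseChangeRep {R A G Λ : Type*} [CommRing R] [CommRing A] [Algebra R A] [Monoid G]
    [AddCommGroup Λ] [Module R Λ] (ρ : Representation R G Λ) :
    ∃ σ : Representation A G (A ⊗[R] Λ), ∀ (g : G) (a : A) (x : Λ), σ g (a ⊗ₜ[R] x) = a ⊗ₜ[R] ρ g x := by
  refine ⟨{ toFun := fun g => (ρ g).baseChange A
            map_one' := by rw [map_one]; exact LinearMap.baseChange_one R Λ
            map_mul' := fun g h => by rw [map_mul]; exact LinearMap.baseChange_mul _ _ }, fun g a x => ?_⟩
  exact LinearMap.baseChange_tmul _ _ _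

/-- `1 ⊗ x ≠ 0` in `A ⊗_R M` for `x ≠ 0` in a FLAT `R`-module `M` when `R → A` is injective (tensor the injection
`R ↪ A` with `M`). [cite: SerreLinearRepresentations1977, §15.2] -/
theorem one_tmul_ne_zero {R A M : Type*} [CommRing R] [CommRing A] [Algebra R A] [AddCommGroup M] [Module R M]
    [Module.Flat R M] (hRA : Function.Injective (algebraMap R A)) {x : M} (hx : x ≠ 0) :
    (1 : A) ⊗ₜ[R] x ≠ 0 := by
  have hinj : Function.Injective (Algebra.linearMap R A) := fun a b h => hRA (by simpa [Algebra.linearMap_apply] using h)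
  have h := Module.Flat.rTensor_preserves_injective_linearMap (M := M) (Algebra.linearMap R A) hinj
  intro h0
  apply hx
  have h1 : (Algebra.linearMap R A).rTensor M ((1 : R) ⊗ₜ[R] x) = (Algebra.linearMap R A).rTensor M 0 := by
    rw [LinearMap.rTensor_tmul, Algebra.linearMap_apply, map_one, h0, map_zero]
  have h2 : (1 : R) ⊗ₜ[R] x = 0 := h h1
  simpa using congrArg (TensorProduct.lid R M) h2

/-! ### The translation representation on `Λ_Q(f)` and the nonvanishing of `Λ_Q(f)` -/

section Lattice

variable (p M : ℕ) [Fact p.Prime] [NeZero M] (hpM : Nat.Coprime p M)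
  [Fintype (diagTorus (ZMod p))] [Invertible (Fintype.card (diagTorus (ZMod p)) : ℤ_[p])]

/-- **The translation representation on the K-line lattice**: right translation of functions preserves `Λ_Q(f)`
(`spreadLattice_translate_mem`), so `g ↦ (F ↦ (x ↦ F(x g)))` is a `ℤ_p`-linear representation of `GL₂(𝔽_p)` on `Λ_Q(f)`
whose underlying functions are `funTranslate`. [cite: AshStevens1986, §1 (1.2)] -/
theorem exists_translationRep (f : CuspForm (Gamma0 (p ^ 2 * M)) 2) :
    ∃ ρ : Representation ℤ_[p] (GL (Fin 2) (ZMod p)) (spreadLattice ℤ_[p] p M hpM f),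
      ∀ (g : GL (Fin 2) (ZMod p)) (F : spreadLattice ℤ_[p] p M hpM f),
        ((ρ g F : spreadLattice ℤ_[p] p M hpM f) : GL (Fin 2) (ZMod p) → _) = funTranslate p g F.1 := by
  -- translation on all functions, as linear maps
  let T : GL (Fin 2) (ZMod p) →
      (GL (Fin 2) (ZMod p) → ℤ_[p] ⊗[ℤ] (periodLattice f).toIntSubmodule) →ₗ[ℤ_[p]]
        (GL (Fin 2) (ZMod p) → ℤ_[p] ⊗[ℤ] (periodLattice f).toIntSubmodule) :=
    fun g => LinearMap.funLeft ℤ_[p] _ (fun x => x * g)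
  have hT : ∀ g, ∀ F ∈ spreadLattice ℤ_[p] p M hpM f, T g F ∈ spreadLattice ℤ_[p] p M hpM f :=
    fun g F hF => spreadLattice_translate_mem ℤ_[p] p M hpM f g hF
  refine ⟨{ toFun := fun g => (T g).restrict (hT g)
            map_one' := ?_
            map_mul' := fun g h => ?_ }, fun g F => rfl⟩
  · apply LinearMap.ext
    intro F
    apply Subtype.ext
    funext x
    change F.1 (x * 1) = F.1 x
    rw [mul_one]
  · apply LinearMap.ext
    intro F
    apply Subtype.ext
    funext x
    change F.1 (x * (g * h)) = F.1 (x * g * h)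
    rw [mul_assoc]

/-- **`Λ_Q(f) ≠ 0` for a newform with rational coefficients**: `Λ_f` is a lattice in `ℂ` (tree theorem
`isZLattice_periodLattice_holds`), so has a nonzero element `λ`; `1 ⊗ λ ≠ 0` in `ℤ_p ⊗_ℤ Λ_f` (flatness), and evaluation at
`g = 1` maps `Λ_Q(f)` onto `ℤ_p ⊗ Λ_f`. [cite: Shimura1971, Thm. 7.14] [cite: AshStevens1986, §1 (1.3)] -/
theorem exists_spreadElt_ne_zero (f : CuspForm (Gamma0 (p ^ 2 * M)) 2) (hf : IsNewform0 f) (hQ : coeffField f = ⊥) :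
    ∃ z : H1carrier ℤ_[p] p M, spreadElt ℤ_[p] p M hpM f z ≠ 0 := by
  haveI : NeZero (p ^ 2 * M) := neZero_sq_mul p M
  -- a nonzero period
  obtain ⟨_, hZ⟩ := isZLattice_periodLattice_holds (f := f) hf hQ
  obtain ⟨lam, hlam⟩ : ∃ lam : (periodLattice f).toIntSubmodule, lam ≠ 0 := by
    by_contra hall
    push Not at hall
    have hspan := hZ.span_top
    have hbot : (Submodule.span ℝ ((periodLattice f).toIntSubmodule : Set ℂ)) = ⊥ := by
      rw [Submodule.span_eq_bot]
      intro x hx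
      have := hall ⟨x, hx⟩
      simpa using congrArg Subtype.val this
    rw [hbot] at hspan
    exact bot_ne_top hspan
  -- `1 ⊗ λ ≠ 0` in `ℤ_p ⊗ Λ_f`
  have h1 : (1 : ℤ_[p]) ⊗ₜ[ℤ] lam ≠ 0 :=
    one_tmul_ne_zero (R := ℤ) (A := ℤ_[p]) (fun a b h => by exact_mod_cast h) hlam
  -- lift along evaluation at `1`
  obtain ⟨F, ⟨z, rfl⟩, hF1⟩ := eval_one_spreadLattice_surjective ℤ_[p] p M hpM f ((1 : ℤ_[p]) ⊗ₜ[ℤ] lam)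
  refine ⟨z, fun h0 => h1 ?_⟩
  rw [← hF1]
  have := congrArg Subtype.val h0
  rw [coe_spreadElt] at this
  rw [this]
  rfl

end Lattice

/-! ### (I1ᴷ) from the tame-type fact -/

set_option maxHeartbeats 400000 in
/-- **(I1ᴷ) from the TYPE of the full-level homology.**  The route-posited automorphic input
`TamePrincipalSeriesFunctionalOverField` of the K-line follows from the published fact
`fullLevelHomology_isIsotypic_tamePrincipalSeries` (Eichler–Shimura at level `K(p)K₀(M)` + local–global compatibility +
the `K(p)`-type of the tame principal series: the `f_W`-part of the full-level homology is `Ind(ω̃^{−b} ⊗ ω̃ᵇ)`-isotypic):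
`V = ℚ_p ⊗ Λ_Q(f_D)` is a nonzero Hecke-trivialised equivariant quotient of the carrier, hence isotypic, hence (Maschke) admits
a `ℚ_p[GL₂(𝔽_p)]`-linear map to the type not killing `1 ⊗ Π_{f_D}(z₀)`.  BSD is not proved by this; (I1ᴷ) becomes
CONDITIONAL on a cite-only published fact instead of route-posited.
[cite: ConradDiamondTaylor1999, Lemma 4.2.4 (2), §5.3, Lemma 7.1.3 (2)] [cite: AshStevens1986, §1 (1.2)–(1.4)]
[cite: SerreLinearRepresentations1977, §2.6 Thm. 8, §15.2] -/
theorem tamePrincipalSeriesFunctionalOverField_of_tameType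
    (hT : fullLevelHomology_isIsotypic_tamePrincipalSeries) : TamePrincipalSeriesFunctionalOverField := by
  intro p M _ _ _ hpM _ _ W _ _ hN D hp11 hadd hirr hGo hV4
  haveI : NeZero (p ^ 2 * M) := neZero_sq_mul p M
  have hp5 : 5 ≤ p := le_trans (by norm_num) hp11
  -- the fact's hypotheses from the prefix
  have hPGO : W.HasPotentiallyGoodOrdinaryReductionAtPrime p :=
    W.hasPotentiallyGoodOrdinaryReductionAtPrime_of_forall_intermediateField p Fact.out hGo
  have hv6 : padicValInt p W.minimalDiscriminantInt ≠ 6 := by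
    rcases TameExponent.padicValInt_mem W p hp5 hadd hV4 with h | h | h <;> omega
  have heb : 12 / Nat.gcd 12 (padicValInt p W.minimalDiscriminantInt) * tameExponent p W = p - 1 :=
    TameExponent.semistabilityIndex_mul_tameExponent W p hp5 hadd hGo hV4
  -- the lattice, its translation representation and the base change to `ℚ_p`
  haveI := KOfPrincipalSeriesFunctional.moduleFinite_spreadLattice p M hpM D.f
  obtain ⟨ρ, hρ⟩ := exists_translationRep p M hpM D.f
  obtain ⟨σ, hσ⟩ : ∃ σ : Representation ℚ_[p] (GL (Fin 2) (ZMod p)) (ℚ_[p] ⊗[ℤ_[p]] spreadLattice ℤ_[p] p M hpM D.f),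
      ∀ (g : GL (Fin 2) (ZMod p)) (a : ℚ_[p]) (x : spreadLattice ℤ_[p] p M hpM D.f),
        σ g (a ⊗ₜ[ℤ_[p]] x) = a ⊗ₜ[ℤ_[p]] ρ g x :=
    exists_baseChangeRep (A := ℚ_[p]) ρ
  -- `Φ = (1 ⊗ ·) ∘ spreadElt`
  let ι : spreadLattice ℤ_[p] p M hpM D.f →ₗ[ℤ_[p]] ℚ_[p] ⊗[ℤ_[p]] spreadLattice ℤ_[p] p M hpM D.f :=
    TensorProduct.mk ℤ_[p] ℚ_[p] (spreadLattice ℤ_[p] p M hpM D.f) 1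
  let Φ : H1carrier ℤ_[p] p M →ₗ[ℤ_[p]] ℚ_[p] ⊗[ℤ_[p]] spreadLattice ℤ_[p] p M hpM D.f :=
    ι.comp (LinearMap.rangeRestrict (spreadPeriod ℤ_[p] p M hpM D.f))
  have hΦ : ∀ z, Φ z = (1 : ℚ_[p]) ⊗ₜ[ℤ_[p]] spreadElt ℤ_[p] p M hpM D.f z := fun z => rfl
  -- `spreadElt` intertwines the carrier action with `ρ`
  have hρ' : ∀ (g : GL (Fin 2) (ZMod p)) (z : H1carrier ℤ_[p] p M),
      spreadElt ℤ_[p] p M hpM D.f (H1carrierRep ℤ_[p] p M g z) = ρ g (spreadElt ℤ_[p] p M hpM D.f z) := by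
    intro g z
    rw [spreadElt_H1carrierRep]
    exact Subtype.ext (hρ g (spreadElt ℤ_[p] p M hpM D.f z)).symm
  -- equivariance of `Φ`
  have hG : ∀ (g : GL (Fin 2) (ZMod p)) (z : H1carrier ℤ_[p] p M), Φ (H1carrierRep ℤ_[p] p M g z) = σ g (Φ z) := by
    intro g z
    rw [hΦ, hΦ, hρ', hσ]
  -- Hecke trivialisation of `Φ` at `W`
  have hTq : ∀ (q : ℕ) [NeZero q] (hq : q.Prime) (hqp : q ≠ p) (z : H1carrier ℤ_[p] p M),
      Φ (heckeT ℤ_[p] p M hq hqp z) = ((W.LFunction q : ℤ) : ℚ_[p]) • Φ z := by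
    intro q _ hq hqp z
    have hTf : HeckeRing0.toEnd (p ^ 2 * M) 2 (HeckeRing0.T (p ^ 2 * M) 2 q hq) D.f = ((W.LFunction q : ℤ) : ℂ) • D.f := by
      have hcoef : (UpperHalfPlane.qExpansion 1 ⇑D.f).coeff q = ((W.LFunction q : ℤ) : ℂ) := D.isNewformOf.2 q
      rw [HeckeRing0.toEnd_T, D.isNewformOf.1.heckeT_eq_coeff_smul hq, hcoef]
    have hsm : spreadElt ℤ_[p] p M hpM D.f (heckeT ℤ_[p] p M hq hqp z) =
        ((W.LFunction q : ℤ) : ℤ_[p]) • spreadElt ℤ_[p] p M hpM D.f z :=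
      Subtype.ext (by rw [coe_spreadElt, spreadPeriod_heckeT ℤ_[p] p M hpM hq hqp hTf z, Submodule.coe_smul, coe_spreadElt])
    rw [hΦ, hΦ, hsm, Int.cast_smul_eq_zsmul, TensorProduct.tmul_smul, Int.cast_smul_eq_zsmul]
  -- the image of `Φ` spans `V`
  have hspan : Submodule.span ℚ_[p] (Set.range Φ) = ⊤ := by
    rw [eq_top_iff]
    rintro v -
    induction v using TensorProduct.induction_on with
    | zero => exact Submodule.zero_mem _
    | tmul a F =>
      obtain ⟨z, hz⟩ := F.2
      have hF : F = spreadElt ℤ_[p] p M hpM D.f z := Subtype.ext hz.symm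
      have hmem : (1 : ℚ_[p]) ⊗ₜ[ℤ_[p]] F ∈ Submodule.span ℚ_[p] (Set.range Φ) :=
        Submodule.subset_span ⟨z, by rw [hΦ, hF]⟩
      have := Submodule.smul_mem _ a hmem
      rwa [TensorProduct.smul_tmul', smul_eq_mul, mul_one] at this
    | add x y hx hy => exact Submodule.add_mem _ hx hy
  -- the fact: `V` is isotypic of the tame principal-series type
  have hiso := hT p M W (tameExponent p W) hp5 hpM hN hPGO hv6 heb ℚ_[p]
    (ℚ_[p] ⊗[ℤ_[p]] spreadLattice ℤ_[p] p M hpM D.f) σ Φ hG hTq hspan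
  -- a nonzero vector of `V` in the image of `Φ`
  obtain ⟨z₀, hz₀⟩ := exists_spreadElt_ne_zero p M hpM D.f D.isNewformOf.1 D.isNewformOf.coeffField_eq_bot
  have hΦz₀ : Φ z₀ ≠ 0 := by
    rw [hΦ]
    exact one_tmul_ne_zero (R := ℤ_[p]) (A := ℚ_[p]) (IsFractionRing.injective ℤ_[p] ℚ_[p]) hz₀
  -- Maschke + isotypy: a `ℚ_p[GL₂(𝔽_p)]`-linear map to the type seeing `Φ z₀`
  haveI : IsSemisimpleModule (MonoidAlgebra ℚ_[p] (GL (Fin 2) (ZMod p))) σ.asModule := inferInstance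
  obtain ⟨θ, hθ⟩ := exists_linearMap_apply_ne_zero_of_isIsotypicOfType hiso (v := (Φ z₀ : σ.asModule)) hΦz₀
  -- back to an intertwining `ℚ_p`-linear map (kept opaque)
  obtain ⟨θ', hθ'⟩ : ∃ θ' : σ.IntertwiningMap
      (coordRep (reduceChar ℚ_[p] (Kato2004.teichmullerChar p ^ (p - 1 - tameExponent p W)))
        (reduceChar ℚ_[p] (Kato2004.teichmullerChar p ^ tameExponent p W))), ∀ v, θ' v = θ v :=
    ⟨(Representation.IntertwiningMap.equivLinearMapAsModule _ _).symm θ, fun v => rfl⟩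
  -- the functional `Ψ = θ' ∘ (1 ⊗ ·)`, kept opaque
  obtain ⟨Ψ, hΨ⟩ : ∃ Ψ : spreadLattice ℤ_[p] p M hpM D.f →ₗ[ℤ_[p]] (Option (ZMod p) → ℚ_[p]),
      ∀ F, Ψ F = θ' ((1 : ℚ_[p]) ⊗ₜ[ℤ_[p]] F) :=
    ⟨(θ'.toLinearMap.restrictScalars ℤ_[p]).comp ι, fun F => rfl⟩
  refine ⟨ℚ_[p], inferInstance, inferInstance, inferInstance, inferInstance, Ψ, ?_, ?_⟩
  · -- equivariance
    intro F g
    have hFg : (⟨funTranslate p g F.1, spreadLattice_translate_mem ℤ_[p] p M hpM D.f g F.2⟩ :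
        spreadLattice ℤ_[p] p M hpM D.f) = ρ g F := Subtype.ext (hρ g F).symm
    -- (no `rw` with a `Subtype.mk`-headed pattern: go through `ρ g F`)
    have key : Ψ (ρ g F) =
        coordRep (reduceChar ℚ_[p] (Kato2004.teichmullerChar p ^ (p - 1 - tameExponent p W)))
          (reduceChar ℚ_[p] (Kato2004.teichmullerChar p ^ tameExponent p W)) g (Ψ F) := by
      have h2 := Representation.IntertwiningMap.isIntertwining _ _ θ' g ((1 : ℚ_[p]) ⊗ₜ[ℤ_[p]] F)
      rw [hσ g 1 F] at h2
      rw [hΨ, hΨ]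
      exact h2
    rw [TwistedQuotient.resScalars_apply, ← key]
    exact congrArg Ψ hFg
  · -- nonvanishing
    intro h0
    apply hθ
    have h1 : Ψ (spreadElt ℤ_[p] p M hpM D.f z₀) = 0 := by rw [h0, LinearMap.zero_apply]
    rw [hΨ, hθ', ← hΦ] at h1
    exact h1

/-! ### K and GE11 from modularity, the tame-type fact and (W‴) -/

/-- **K from modularity, the published TAME-TYPE fact and the Ash–Stevens weight exclusion (W‴).**  Conclusion = the route
decl `TwistedPeriodLatticeSaturation` VERBATIM; BSD is not proved by this; K is proved CONDITIONALLY on modularity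
(`exists_isNewformOf`), the cite-only fact `fullLevelHomology_isIsotypic_tamePrincipalSeries` and the route-posited (W‴).
[cite: EdixhovenManin1991, §4] [cite: ConradDiamondTaylor1999, Lemma 4.2.4 (2), §5.3] -/
theorem twistedPeriodLatticeSaturation_of_tameType_of_noEtaleWeightEigenQuotient (hnf : exists_isNewformOf)
    (hT : fullLevelHomology_isIsotypic_tamePrincipalSeries) (hW : NoEtaleWeightEigenQuotient) :
    Summit.BirchSwinnertonDyer.BirchSwinnertonDyer.Theses.TeichmullerTwistDescent.TwistedPeriodLatticeSaturation :=
  KOfPrincipalSeriesFunctional.twistedPeriodLatticeSaturation_of_field_of_noEtaleWeightEigenQuotient hnf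
    (tamePrincipalSeriesFunctionalOverField_of_tameType hT) hW

/-- **GE11 from modularity, Edixhoven's Kodaira-type theorem, the tame-type fact and (W‴).**
`OrdinaryLowValuationOptimalManinUnitGeEleven` (route decl verbatim); BSD is not proved by this; GE11 is proved
CONDITIONALLY on the four named hypotheses. [cite: EdixhovenManin1991, §4 and Thm. 3] [cite: Stevens1989, Lemma (5.2)] -/
theorem ordinaryLowValuationOptimalManinUnitGeEleven_of_tameType_inputs (hnf : exists_isNewformOf)
    (hEdix : edixhoven_not_dvd_maninConstant_of_kodairaSymbol_ne)
    (hT : fullLevelHomology_isIsotypic_tamePrincipalSeries) (hW : NoEtaleWeightEigenQuotient) :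
    OrdinaryLowValuationOptimalManinUnitGeEleven :=
  KOfPrincipalSeriesFunctional.ordinaryLowValuationOptimalManinUnitGeEleven_of_field_inputs hnf hEdix
    (tamePrincipalSeriesFunctionalOverField_of_tameType hT) hW

end KOfTameType

end Summit.BirchSwinnertonDyer.BirchSwinnertonDyer.Theorems.TeichmullerTwistDescent
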